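import Mathlib

/-!
# T5GaloisTransport — an automorphism of the top ring over an automorphism of the base ring
transports the primes over `𝔭` to the primes over `σ 𝔭`

Kernel witness (cell pub-hodge-repro2, seat p3, Tier-5 support for sub-step N2) for the clause
of route/T5-N2-route-3.md §N2.8.2(c): «and «w non-split in E» is constant on the
Gal(F⁺/ℚ)-orbit of dyadic places since every σ ∈ Gal(F⁺/ℚ) extends to E (E/ℚ Galois) ✓ — so
D = ∅ or D = all».

What is kernel-checked here (Mathlib only): for an `A`-algebra `B`, a ring automorphism `τ` of
`B` lying over a ring automorphism `σ` of `A` (`τ ∘ algebraMap = algebraMap ∘ σ`),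

* `under_comap`: `(τ⁻¹ P) ∩ A = σ⁻¹ (P ∩ A)` — the contraction commutes with the transport;
* `liesOver_comap`: `P` lies over `𝔭` ⟹ `τ⁻¹ P` lies over `σ⁻¹ 𝔭`;
* `primesOverEquiv`: the bijection `primesOver 𝔭 B ≃ primesOver (σ⁻¹ 𝔭) B`, `P ↦ τ⁻¹ P`;
* `ncard_primesOver_comap`: hence the NUMBER of primes of `B` over `𝔭` equals the number over
  `σ⁻¹ 𝔭` — «the splitting behaviour of `w` in `E` is constant along the `Gal(F⁺/ℚ)`-orbit»
  once every `σ` is known to lift to a `τ` (`T5CoprimeCompositum.exists_extension_of_normal`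
  at the field level).

What stays prose (labels unchanged): the passage from the field automorphisms of
`exists_extension_of_normal` to automorphisms of the rings of integers (Mathlib's `galRestrict`),
and the reading of «non-split» as «more than one prime above».

README §8(d): this file uses an L-value-free non-vanishing device: NO.
-/

namespace Summit.Ventures.HodgeRepro2.T5GaloisTransport

open Ideal

/-- `e ∘ e⁻¹ = id` as ring homomorphisms (coerced form). -/
theorem coe_comp_coe_symm {R : Type*} [Semiring R] (e : R ≃+* R) :
    (e : R →+* R).comp (e.symm : R →+* R) = RingHom.id R := by
  ext x
  simp

/-- `e⁻¹ ∘ e = id` as ring homomorphisms (coerced form). -/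
theorem coe_symm_comp_coe {R : Type*} [Semiring R] (e : R ≃+* R) :
    (e.symm : R →+* R).comp (e : R →+* R) = RingHom.id R := by
  ext x
  simp

variable {A B : Type*} [CommRing A] [CommRing B] [Algebra A B]
  (σ : A ≃+* A) (τ : B ≃+* B) (hcomm : ∀ a, τ (algebraMap A B a) = algebraMap A B (σ a))

include hcomm

/-- The compatibility as an equality of ring homomorphisms. -/
theorem comp_algebraMap :
    (τ : B →+* B).comp (algebraMap A B) = (algebraMap A B).comp (σ : A →+* A) :=
  RingHom.ext hcomm

/-- The contraction to `A` commutes with the transport: `(τ⁻¹ P) ∩ A = σ⁻¹ (P ∩ A)`. -/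
theorem under_comap (P : Ideal B) :
    (P.comap (τ : B →+* B)).under A = (P.under A).comap (σ : A →+* A) := by
  rw [Ideal.under, Ideal.under, Ideal.comap_comap, Ideal.comap_comap, comp_algebraMap σ τ hcomm]

/-- `P` lies over `𝔭` ⟹ `τ⁻¹ P` lies over `σ⁻¹ 𝔭`. -/
theorem liesOver_comap (p : Ideal A) (P : Ideal B) (h : P.LiesOver p) :
    (P.comap (τ : B →+* B)).LiesOver (p.comap (σ : A →+* A)) :=
  ⟨by rw [under_comap σ τ hcomm P, ← h.over]⟩

/-- The inverse automorphisms are compatible as well. -/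
theorem symm_comm (a : A) : τ.symm (algebraMap A B a) = algebraMap A B (σ.symm a) := by
  apply τ.injective
  rw [RingEquiv.apply_symm_apply, hcomm, RingEquiv.apply_symm_apply]

/-- `τ⁻¹ P ∈ primesOver (σ⁻¹ 𝔭)` for `P ∈ primesOver 𝔭`. -/
theorem comap_mem_primesOver (p : Ideal A) {P : Ideal B} (hP : P ∈ primesOver p B) :
    P.comap (τ : B →+* B) ∈ primesOver (p.comap (σ : A →+* A)) B :=
  ⟨Ideal.IsPrime.comap (hK := hP.1) _, liesOver_comap σ τ hcomm p P hP.2⟩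

/-- The bijection `primesOver 𝔭 B ≃ primesOver (σ⁻¹ 𝔭) B`, `P ↦ τ⁻¹ P`. -/
def primesOverEquiv (p : Ideal A) : primesOver p B ≃ primesOver (p.comap (σ : A →+* A)) B where
  toFun P := ⟨P.1.comap (τ : B →+* B), comap_mem_primesOver σ τ hcomm p P.2⟩
  invFun Q := ⟨Q.1.comap (τ.symm : B →+* B), by
    have h := comap_mem_primesOver σ.symm τ.symm (symm_comm σ τ hcomm) (p.comap (σ : A →+* A)) Q.2
    rwa [Ideal.comap_comap, coe_comp_coe_symm, Ideal.comap_id] at h⟩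
  left_inv P := Subtype.ext (by
    change (P.1.comap (τ : B →+* B)).comap (τ.symm : B →+* B) = P.1
    rw [Ideal.comap_comap, coe_comp_coe_symm, Ideal.comap_id])
  right_inv Q := Subtype.ext (by
    change (Q.1.comap (τ.symm : B →+* B)).comap (τ : B →+* B) = Q.1
    rw [Ideal.comap_comap, coe_symm_comp_coe, Ideal.comap_id])

/-- The number of primes over `𝔭` equals the number of primes over `σ⁻¹ 𝔭`: the splitting
behaviour is constant along the orbit of `𝔭` under automorphisms that lift. -/
theorem ncard_primesOver_comap (p : Ideal A) :
    (primesOver p B).ncard = (primesOver (p.comap (σ : A →+* A)) B).ncard := by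
  rw [← Nat.card_coe_set_eq, ← Nat.card_coe_set_eq]
  exact Nat.card_congr (primesOverEquiv σ τ hcomm p)

end Summit.Ventures.HodgeRepro2.T5GaloisTransport
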